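import Summits.QuantumFields.BalabanUV.Beta.SymmetrisedStepJetsUnits
import Summits.QuantumFields.BalabanUV.Beta.D1BFx.PackedKernelSplit

/-!
# `BalabanUV.Beta.FP.SymJetBlockRows` — road «FP» for binder row D1, ROW KER-γ sub-row (γ), OWNER HALF: THE `field ⊕ multiplier` BLOCK ROWS OF THE
# (0.4) LITERAL's TABLES `(JsB12Sym0 hLc N tabs cΛ cB j).S ∕ .W` (an2 `SymmetrisedStepJets` ✓, sectors `SymmetrisedStepJetsUnits` ✓) read with
# `D1BFx.PackedKernelSplit.blk`: WHICH SECTOR FEEDS THE GLUON (`tt`) WORD AND WHICH THE MIX WORDS of the (LEDGER) skeleton `FineHessianNearLedgerCore.nearSplit_of_slice`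
# (`Ssl`∕`Wsl` = `tt` blocks via α2-a PART 1 `FineHessianBlockSplit`; `Fmix` = block terms via α2-a PART 2 `BlockTermsPieces`)

HONEST DEPENDENCY (page 1, mandatory): continuum YM on T⁴ ⇐ BetaPertH ∧ nine spine estimates (0/9 proved); BetaPertH ⇐ (D1) ∧ (D4) ∧ CAP+tail;
G-an2-4 gates asym, D1 and NE2/3/4.  HONEST FRAMING (cell contract, verbatim): «discharging `BetaPertH` makes Bałaban's UV stability UNCONDITIONAL —
a real constructive-QFT result; it is NOT the continuum limit and NOT the Clay problem.»  THIS MODULE DISCHARGES NOTHING of the wall: [folklore] FIBRE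
BOOKKEEPING (`rfl`-grade block readings of superpositions and of the four constructors that are field–field by construction).  No `def`, no `def … : Prop`,
nothing cited, 0 sorry; 0∕4 row-D1 binders; NOT (γ)'s units half, NOT `hslice`, NOT (ASYMP), NOT D1, NOT BetaPertH, NOT continuum, NOT Clay.  «not in print».
ABSOLUTE RULE (cell charter, verbatim): «No internally-minted statement may enter as a cited fact. Every hypothesis is either kernel-proved in this package or a
verbatim quotation of a PUBLISHED theorem with page reference. The manuscript(s) under audit are NOT citable for their own disputed steps — they are the thing
under adjudication; programme-internal (2001/route/tribunal) claims are never citable.»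
NOTATION.  `blk K b b′`: `true` = field leg, `false` = multiplier leg; `tt` = field–field (the gluon word's fibre), `tf`∕`ft` = field–multiplier (the MIX words'
fibre), `ff` = multiplier–multiplier.  THE RECORD's BLOCK LETTERS are DISPLAYED HYPOTHESES where used (NOT fields of `SymTables` today): (BH) `tabs.H μ y` is
`tt`-only; (BV) `tabs.V κ u` has zero `tt`∕`ff` blocks; (BM) `tabs.M j` is `tt`-only; (Bmix) `tabs.mixFF` is `tt`-only — true BY CONSTRUCTION for the comb values
(`hessFFAt`∕`mixFFAt` match on `(inl, inl)` only; the border `vhSAt = packVH …` lives on `(inl, inr)`∕`(inr, inl)` only) and preserved by a symmetrisation acting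
inside the blocks; whether an1's TABLES-SYM exhibits them is for an1∕an2 to confirm — NOT decided here.
WHAT.  §1 [folklore] `blk` commutes with `+`, `•`, `wsum`, `onLat`∕`cwsum`; `vertexOfK`∕`vertexOfM`∕`dM`∕`vertex2OfK`∕`mixOfK`∕`SLam` read blockwise (CONGRUENCE:
the `(b,b′)` block of the superposition depends only on the `(b,b′)` blocks of the members — the scalar WEIGHTS keep every block of `K`; VANISHING: it vanishes
when those do).  §2 [folklore] THE FOUR `tt`-ONLY CONSTRUCTORS `wilsonA`, `wilsonW₂`, `mmRead` — hence `e3OfK` (propagated cubic) and `e4OfKW` (propagated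
quartic): every other block is `0`.  §3 [folklore] THE FIRST-ORDER ROWS, levels `0`∕`j+1`, all blocks sector by sector; OFF `tt` the cubic sector is ABSENT
(border `−Lc⁸∕2·wVH` + Λ-sector `cΛ·wΛ`); under (BH) the off-`tt` rows are THE BORDER SECTOR ALONE; under (BV) the `tt` row is cubic + Λ (NO border); under
(BV)+(BH) the `ff` row is `0`; the pure part `SpureSymOf` off `tt` is the border UNCONDITIONALLY.  §4 [folklore] THE SECOND-ORDER ROWS: `T2RecOf … j` off `tt` is
the second-order border `cB·wB2 • tabs.vh₂S` alone; `W_j = W2SymOfK (Gsym Lc j) Lc Spure_j (tabs.M j) T2_j (M2Of mixFF j)` summand by summand (`W2OfK_apply`):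
off `tt` the `vertex2OfK` summands see only the second-order border, the two `mixOfK` summands VANISH under (Bmix), the `dM (K2OfK …)` summand sees only the
first-order border of `Spure_j` under (BM) (its weights, the columns of `K2OfK`, keep every block); all four vanish where the border tables do.
CONSEQUENCE FOR PART 3 (read, not re-proved): `Ssl m`∕`Wsl m` carry cubic∕Λ resp. quartic∕mixed∕response sectors and NO border; the MIX words are fed by
EXACTLY the two border tables `tabs.V` (weight `−Lc⁸∕2·(Lc^j)¹⁰`) and `tabs.vh₂S` (weight `cB·(Lc^j)¹⁵`) plus the leg's own off-diagonal blocks; (G8) = the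
`dM (K2OfK …)` summand, (G-mix-W) = the two `mixOfK` summands, read with the same rows.
Provenance: road FP OWNER b2b-balaban-beta-d1-p3 gen 10 (prover-b2b-balaban-beta-d1-p3-g10-0), 2026-08-21, sub-row (γ) owner half (memo
`HOME/b2b-balaban-beta-d1-p3/KER-GAMMA-ALPHA2.md` §10; journal INTENT 2026-08-21T07:14Z).
-/

noncomputable section

namespace Summit.QuantumFields.BalabanUV.Beta.FP.SymJetBlockRows

open Finset
open scoped BigOperators
open Literature.MathematicalPhysics.QuantumFieldTheory
open Literature.MathematicalPhysics.QuantumFieldTheory.Balaban1983to89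
open Literature.MathematicalPhysics.QuantumFieldTheory.Balaban1983to89.Beta
open ExpKernelCalculus (MKer)
open OneStepResolventKernel (Fib KInv wsum)
open OneStepKernelFamily (KInvStep vertexOfK colH)
open SecondOrderResponse (vertexOfM dM K2OfK vertex2OfK mixOfK W2OfK W2SymOfK colM W2OfK_apply)
open InterLevelTransport (cwsum onLat SLam)
open BalabanStepJets (lamCoeffOf)
open BalabanStepJetsSucc (mmRead E2 lamCoeffK wE wVH wΛ)
open BalabanStepW2 (M2Of wV4 wB2 K3OfK)
open StepJetData (wilsonA)
open WilsonBiStencil (wilsonW₂)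
open WilsonVertex2Sym (wsym22)
open Summit.QuantumFields.BalabanUV.Beta.D1BFx.PackedKernelSplit (inj blk)
open Summit.QuantumFields.BalabanUV.Beta.SpineRooted (e3OfK e4OfKW T2RecOf WrecOf T2RecOf_zero_level T2RecOf_succ SpureRecOf
  SpureRecOf_zero_level SpureRecOf_succ)
open Summit.QuantumFields.BalabanUV.Beta.WardLocusRecursive (SrecOf)
open Summit.QuantumFields.BalabanUV.Beta.SymmetrisedStepJets
open Summit.QuantumFields.BalabanUV.Beta.SymmetrisedStepJetsUnits (JsB12Sym0_S_zero JsB12Sym0_S_succ JsB12Sym0_W_eq T2Rec_JsB12Sym_zero)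

/-! ## §1 Block calculus: sums, superpositions, congruence and vanishing -/

section Calculus

variable {D : ℕ} {F : Type*}

/-- [folklore] blocks of a sum. -/
theorem blk_add (K L : MKer D (F ⊕ F)) (i j : Bool) : blk (K + L) i j = blk K i j + blk L i j := rfl

/-- [folklore] blocks of a scalar multiple. -/
theorem blk_smul (c : ℝ) (K : MKer D (F ⊕ F)) (i j : Bool) : blk (c • K) i j = c • blk K i j := rfl

/-- [folklore] blocks of zero. -/
theorem blk_zero (i j : Bool) : blk (0 : MKer D (F ⊕ F)) i j = 0 := rfl

/-- [folklore] blocks of an absolutely indexed superposition `wsum w T = Σ'_u w u · T u`. -/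
theorem blk_wsum (w : (Fin D → ℤ) → ℝ) (T : (Fin D → ℤ) → MKer D (F ⊕ F)) (i j : Bool) :
    blk (wsum w T) i j = wsum w (fun u => blk (T u) i j) := rfl

/-- [folklore] a superposition of a vanishing family vanishes. -/
theorem wsum_family_zero {G : Type*} (w : (Fin D → ℤ) → ℝ) : wsum w (fun _ => (0 : MKer D G)) = 0 := by
  funext x z a b; simp only [wsum, Pi.zero_apply, mul_zero, tsum_zero]

/-- [folklore] VANISHING for `wsum`: a block vanishing on every member vanishes on the superposition. -/
theorem blk_wsum_eq_zero {w : (Fin D → ℤ) → ℝ} {T : (Fin D → ℤ) → MKer D (F ⊕ F)} {i j : Bool} (h : ∀ u, blk (T u) i j = 0) :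
    blk (wsum w T) i j = 0 := by
  rw [blk_wsum, show (fun u => blk (T u) i j) = fun _ => (0 : MKer D F) from funext h]
  exact wsum_family_zero w

end Calculus

section Superpositions

variable {d N : ℕ}

/-- [folklore] blocks of the extension by zero `onLat`. -/
theorem blk_onLat (Q : (Fin (d + 1) → ℤ) → MKer (d + 1) (Fib d)) (i j : Bool) (v : Fin (d + 1) → ℤ) :
    blk (onLat N Q v) i j = onLat N (fun y => blk (Q y) i j) v := by
  unfold onLat; split_ifs <;> rfl

/-- [folklore] blocks of a coarse-indexed superposition `cwsum`. -/
theorem blk_cwsum (w : (Fin (d + 1) → ℤ) → ℝ) (Q : (Fin (d + 1) → ℤ) → MKer (d + 1) (Fib d)) (i j : Bool) :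
    blk (cwsum N w Q) i j = wsum (onLat N w) (onLat N (fun y => blk (Q y) i j)) := by
  unfold cwsum; rw [blk_wsum]; exact congrArg _ (funext (blk_onLat Q i j))

/-- [folklore] VANISHING for `cwsum`. -/
theorem blk_cwsum_eq_zero {w : (Fin (d + 1) → ℤ) → ℝ} {Q : (Fin (d + 1) → ℤ) → MKer (d + 1) (Fib d)} {i j : Bool}
    (h : ∀ y, blk (Q y) i j = 0) : blk (cwsum N w Q) i j = 0 := by
  rw [blk_cwsum, show (fun y => blk (Q y) i j) = fun _ => (0 : MKer (d + 1) (Fin (d + 1))) from funext h]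
  rw [show onLat N (fun _ : Fin (d + 1) → ℤ => (0 : MKer (d + 1) (Fin (d + 1)))) = fun _ => 0 from
    funext fun v => by unfold onLat; split_ifs <;> rfl]
  exact wsum_family_zero _

/-- [folklore] **`vertexOfK` READS BLOCKWISE**: the `(i,j)` block of the chain-rule vertex is the same `ℋ`-column superposition of the `(i,j)` blocks
of the stencils (the weights `colH K N μ y κ′` are scalars and keep EVERY block of `K`). -/
theorem blk_vertexOfK (K : MKer (d + 1) (Fib d)) (N : ℕ) (S : Fin (d + 1) → (Fin (d + 1) → ℤ) → MKer (d + 1) (Fib d))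
    (μ : Fin (d + 1)) (y : Fin (d + 1) → ℤ) (i j : Bool) :
    blk (vertexOfK K N S μ y) i j = fun x z a b => ∑ κ' : Fin (d + 1), wsum (colH K N μ y κ') (fun u => blk (S κ' u) i j) x z a b := rfl

/-- [folklore] CONGRUENCE for `vertexOfK`. -/
theorem blk_vertexOfK_congr (K : MKer (d + 1) (Fib d)) (N : ℕ) {S S' : Fin (d + 1) → (Fin (d + 1) → ℤ) → MKer (d + 1) (Fib d)}
    {i j : Bool} (h : ∀ κ u, blk (S κ u) i j = blk (S' κ u) i j) (μ : Fin (d + 1)) (y : Fin (d + 1) → ℤ) :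
    blk (vertexOfK K N S μ y) i j = blk (vertexOfK K N S' μ y) i j := by
  rw [blk_vertexOfK, blk_vertexOfK]; simp only [h]

/-- [folklore] VANISHING for `vertexOfK`. -/
theorem blk_vertexOfK_eq_zero (K : MKer (d + 1) (Fib d)) (N : ℕ) {S : Fin (d + 1) → (Fin (d + 1) → ℤ) → MKer (d + 1) (Fib d)}
    {i j : Bool} (h : ∀ κ u, blk (S κ u) i j = 0) (μ : Fin (d + 1)) (y : Fin (d + 1) → ℤ) : blk (vertexOfK K N S μ y) i j = 0 := by
  rw [blk_vertexOfK]
  funext x z a b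
  have hw : ∀ κ' : Fin (d + 1), wsum (colH K N μ y κ') (fun u => blk (S κ' u) i j) = 0 := fun κ' => by
    rw [show (fun u => blk (S κ' u) i j) = fun _ => (0 : MKer (d + 1) (Fin (d + 1))) from funext (h κ')]
    exact wsum_family_zero _
  simp only [hw, Pi.zero_apply, Finset.sum_const_zero]

/-- [folklore] VANISHING for `vertexOfM`. -/
theorem blk_vertexOfM_eq_zero (K : MKer (d + 1) (Fib d)) (N : ℕ) {M : Fin (d + 1) → (Fin (d + 1) → ℤ) → MKer (d + 1) (Fib d)}
    {i j : Bool} (h : ∀ ρ w, blk (M ρ w) i j = 0) (μ : Fin (d + 1)) (y : Fin (d + 1) → ℤ) : blk (vertexOfM K N M μ y) i j = 0 := by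
  funext x z a b; simp only [blk, vertexOfM]; refine Finset.sum_eq_zero fun ρ _ => ?_
  have := congrFun (congrFun (congrFun (congrFun (blk_cwsum_eq_zero (N := N) (w := colM K N μ y ρ) (h ρ)) x) z) a) b
  simpa only [blk, Pi.zero_apply] using this

/-- [folklore] **`dM` READS BLOCKWISE**: CONGRUENCE in the field tables together with VANISHING of the multiplier tables' block. -/
theorem blk_dM_of_letters (K : MKer (d + 1) (Fib d)) (N : ℕ) {S S' M : Fin (d + 1) → (Fin (d + 1) → ℤ) → MKer (d + 1) (Fib d)}
    {i j : Bool} (hS : ∀ κ u, blk (S κ u) i j = blk (S' κ u) i j) (hM : ∀ ρ w, blk (M ρ w) i j = 0)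
    (μ : Fin (d + 1)) (y : Fin (d + 1) → ℤ) :
    blk (dM K N S M μ y) i j = blk (vertexOfK K N S' μ y) i j := by
  unfold dM; rw [blk_add, blk_vertexOfK_congr K N hS, blk_vertexOfM_eq_zero K N hM, add_zero]

/-- [folklore] VANISHING for `dM`. -/
theorem blk_dM_eq_zero (K : MKer (d + 1) (Fib d)) (N : ℕ) {S M : Fin (d + 1) → (Fin (d + 1) → ℤ) → MKer (d + 1) (Fib d)}
    {i j : Bool} (hS : ∀ κ u, blk (S κ u) i j = 0) (hM : ∀ ρ w, blk (M ρ w) i j = 0) (μ : Fin (d + 1)) (y : Fin (d + 1) → ℤ) :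
    blk (dM K N S M μ y) i j = 0 := by
  unfold dM; rw [blk_add, blk_vertexOfK_eq_zero K N hS, blk_vertexOfM_eq_zero K N hM, add_zero]

/-- [folklore] CONGRUENCE for the bi-vertex `vertex2OfK` (both slots read through `ℋ`-columns). -/
theorem blk_vertex2OfK_congr (K : MKer (d + 1) (Fib d)) (N : ℕ)
    {S₂ S₂' : Fin (d + 1) → (Fin (d + 1) → ℤ) → Fin (d + 1) → (Fin (d + 1) → ℤ) → MKer (d + 1) (Fib d)} {i j : Bool}
    (h : ∀ κ u κ' u', blk (S₂ κ u κ' u') i j = blk (S₂' κ u κ' u') i j)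
    (μ : Fin (d + 1)) (y : Fin (d + 1) → ℤ) (ν : Fin (d + 1)) (y' : Fin (d + 1) → ℤ) :
    blk (vertex2OfK K N S₂ μ y ν y') i j = blk (vertex2OfK K N S₂' μ y ν y') i j := by
  unfold vertex2OfK; exact blk_vertexOfK_congr K N (fun κ u => blk_vertexOfK_congr K N (h κ u) ν y') μ y

/-- [folklore] VANISHING for `vertex2OfK`. -/
theorem blk_vertex2OfK_eq_zero (K : MKer (d + 1) (Fib d)) (N : ℕ)
    {S₂ : Fin (d + 1) → (Fin (d + 1) → ℤ) → Fin (d + 1) → (Fin (d + 1) → ℤ) → MKer (d + 1) (Fib d)} {i j : Bool}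
    (h : ∀ κ u κ' u', blk (S₂ κ u κ' u') i j = 0) (μ : Fin (d + 1)) (y : Fin (d + 1) → ℤ) (ν : Fin (d + 1)) (y' : Fin (d + 1) → ℤ) :
    blk (vertex2OfK K N S₂ μ y ν y') i j = 0 := by
  unfold vertex2OfK; exact blk_vertexOfK_eq_zero K N (fun κ u => blk_vertexOfK_eq_zero K N (h κ u) ν y') μ y

/-- [folklore] VANISHING for the mixed bi-vertex `mixOfK` (field slot through `ℋ`-columns, multiplier slot through multiplier columns). -/
theorem blk_mixOfK_eq_zero (K : MKer (d + 1) (Fib d)) (N : ℕ)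
    {M₂ : Fin (d + 1) → (Fin (d + 1) → ℤ) → Fin (d + 1) → (Fin (d + 1) → ℤ) → MKer (d + 1) (Fib d)} {i j : Bool}
    (h : ∀ κ u ρ w, blk (M₂ κ u ρ w) i j = 0) (μ : Fin (d + 1)) (y : Fin (d + 1) → ℤ) (ν : Fin (d + 1)) (y' : Fin (d + 1) → ℤ) :
    blk (mixOfK K N M₂ μ y ν y') i j = 0 := by
  unfold mixOfK; exact blk_vertexOfK_eq_zero K N (fun κ u => blk_vertexOfM_eq_zero K N (h κ u) ν y') μ y

/-- [folklore] **`SLam` READS BLOCKWISE, VANISHING FORM**: if every averaging second jet `Q2 μ y` has zero `(i,j)` block, so has the Λ-stencil. -/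
theorem blk_SLam_eq_zero (N : ℕ) (c : Fin (d + 1) → (Fin (d + 1) → ℤ) → Fin (d + 1) → (Fin (d + 1) → ℤ) → ℝ)
    {Q2 : Fin (d + 1) → (Fin (d + 1) → ℤ) → MKer (d + 1) (Fib d)} {i j : Bool} (h : ∀ μ y, blk (Q2 μ y) i j = 0)
    (κ : Fin (d + 1)) (u : Fin (d + 1) → ℤ) : blk (SLam N c Q2 κ u) i j = 0 := by
  funext x z a b; simp only [blk, SLam, Pi.zero_apply, neg_eq_zero]; refine Finset.sum_eq_zero fun μ _ => ?_
  have := congrFun (congrFun (congrFun (congrFun (blk_cwsum_eq_zero (N := N) (w := fun y => c μ y κ u) (h μ)) x) z) a) b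
  simpa only [blk, Pi.zero_apply] using this

end Superpositions

/-! ## §2 The four `tt`-only constructors: Wilson cubic, Wilson quartic, the `mm`-read (propagated cubic and quartic sectors) -/

section TTOnly

variable {d : ℕ}

/-- [folklore] **THE WILSON CUBIC STENCIL IS FIELD–FIELD**: every block of `wilsonA d κ u` other than `tt` is `0`. -/
theorem blk_wilsonA_eq_zero (κ : Fin (d + 1)) (u : Fin (d + 1) → ℤ) {b b' : Bool} (hbb : ¬(b = true ∧ b' = true)) :
    blk (wilsonA d κ u) b b' = 0 := by
  obtain _ | _ := b <;> obtain _ | _ := b' <;> first | rfl | exact absurd ⟨rfl, rfl⟩ hbb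

/-- [folklore] **THE WILSON QUARTIC BI-STENCIL IS FIELD–FIELD**: every block of `wilsonW₂ d T κ u κ′ u′` other than `tt` is `0`. -/
theorem blk_wilsonW₂_eq_zero (T : Fin 4 → Fin 4 → Fin 4 → Fin 4 → ℝ) (κ : Fin (d + 1)) (u : Fin (d + 1) → ℤ) (κ' : Fin (d + 1))
    (u' : Fin (d + 1) → ℤ) {b b' : Bool} (hbb : ¬(b = true ∧ b' = true)) : blk (wilsonW₂ d T κ u κ' u') b b' = 0 := by
  obtain _ | _ := b <;> obtain _ | _ := b' <;> first | rfl | exact absurd ⟨rfl, rfl⟩ hbb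

/-- [folklore] **THE `mm`-READ IS FIELD–FIELD** (it PLACES the multiplier–multiplier block of a fine kernel into the field–field slot of the coarser
lattice, all other blocks `0`): every block of `mmRead M F` other than `tt` is `0`. -/
theorem blk_mmRead_eq_zero (M : ℕ) (F : MKer (d + 1) (Fib d)) {b b' : Bool} (hbb : ¬(b = true ∧ b' = true)) :
    blk (mmRead M F) b b' = 0 := by
  obtain _ | _ := b <;> obtain _ | _ := b' <;> first | rfl | exact absurd ⟨rfl, rfl⟩ hbb

/-- [folklore] The `tt` block of the `mm`-read is the `mm` (= `ff`) block at the dilated points. -/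
theorem blk_mmRead_tt (M : ℕ) (F : MKer (d + 1) (Fib d)) :
    blk (mmRead M F) true true = fun x' z' α β => blk F false false ((M : ℤ) • x') ((M : ℤ) • z') α β := rfl

/-- [folklore] **THE PROPAGATED CUBIC SECTOR `e3OfK N K S κ u = −mmRead N (K∘V∘K)` IS FIELD–FIELD**: every block other than `tt` is `0`. -/
theorem blk_e3OfK_eq_zero (N : ℕ) (K : MKer (d + 1) (Fib d)) (S : Fin (d + 1) → (Fin (d + 1) → ℤ) → MKer (d + 1) (Fib d))
    (κ : Fin (d + 1)) (u : Fin (d + 1) → ℤ) {b b' : Bool} (hbb : ¬(b = true ∧ b' = true)) : blk (e3OfK N K S κ u) b b' = 0 := by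
  have h0 := blk_mmRead_eq_zero N (ExpKernelCalculus.comp (ExpKernelCalculus.comp K (vertexOfK K N S κ u)) K) hbb
  funext x z a c
  have h1 := congrFun (congrFun (congrFun (congrFun h0 x) z) a) c
  simp only [blk, Pi.zero_apply] at h1 ⊢
  simp only [e3OfK, h1, neg_zero]

/-- [folklore] **THE PROPAGATED QUARTIC SECTOR `e4OfKW Lc K S M W = mmRead Lc (K3OfK …)` IS FIELD–FIELD**: every block other than `tt` is `0`. -/
theorem blk_e4OfKW_eq_zero (Lc : ℕ) (K : MKer (d + 1) (Fib d)) (S M : Fin (d + 1) → (Fin (d + 1) → ℤ) → MKer (d + 1) (Fib d))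
    (W : Fin (d + 1) → (Fin (d + 1) → ℤ) → Fin (d + 1) → (Fin (d + 1) → ℤ) → MKer (d + 1) (Fib d))
    (μ : Fin (d + 1)) (y : Fin (d + 1) → ℤ) (ν : Fin (d + 1)) (y' : Fin (d + 1) → ℤ) {b b' : Bool} (hbb : ¬(b = true ∧ b' = true)) :
    blk (e4OfKW Lc K S M W μ y ν y') b b' = 0 :=
  blk_mmRead_eq_zero Lc (K3OfK K Lc S M W μ y ν y') hbb

end TTOnly

/-! ## §3 The literal's first-order rows -/

section FirstOrder

variable {Lc : ℕ} [NeZero Lc] (hLc : Odd Lc) (N : ℕ) (tabs : SymTables 3 Lc) (cΛ cB : ℝ)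

/-- [folklore] **LEVEL 0, EVERY BLOCK, SECTOR BY SECTOR**: Wilson cubic `Lc⁴`, border `−Lc⁸∕2`, Λ-sector `cΛ`. -/
theorem blk_S_zero (κ : Fin 4) (u : Fin 4 → ℤ) (b b' : Bool) :
    blk ((JsB12Sym0 hLc N tabs cΛ cB 0).S κ u) b b' =
      ((Lc : ℝ) ^ 4) • blk (wilsonA 3 κ u) b b' + (-((Lc : ℝ) ^ 8 / 2)) • blk (tabs.V κ u) b b'
        + cΛ • blk (SLam Lc (lamCoeffOf (KInv (N := Lc) (d := 3)) Lc) tabs.H κ u) b b' := by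
  rw [JsB12Sym0_S_zero]; rfl

/-- [folklore] **LEVEL `j+1`, EVERY BLOCK, SECTOR BY SECTOR**: propagated cubic `Lc⁴·wE (j+1)`, border `−Lc⁸∕2·wVH (j+1)`, Λ-sector `cΛ·wΛ (j+1)`. -/
theorem blk_S_succ (j : ℕ) (κ : Fin 4) (u : Fin 4 → ℤ) (b b' : Bool) :
    blk ((JsB12Sym0 hLc N tabs cΛ cB (j + 1)).S κ u) b b' =
      ((Lc : ℝ) ^ 4 * wE 3 Lc (j + 1)) • blk (e3OfK Lc (Gsym Lc j) (JsB12Sym0 hLc N tabs cΛ cB j).S κ u) b b'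
        + (-((Lc : ℝ) ^ 8 / 2) * wVH 3 Lc (j + 1)) • blk (tabs.V κ u) b b'
        + (cΛ * wΛ 3 Lc (j + 1)) • blk (SLam Lc (lamCoeffK (KInvStep (d := 3) Lc (j + 1)) (E2 3 Lc (j + 1)) Lc) tabs.H κ u) b b' := by
  rw [JsB12Sym0_S_succ]; rfl

/-- [folklore] **LEVEL 0 OFF THE `tt` BLOCK: THE CUBIC SECTOR IS ABSENT** — border + Λ-sector only. -/
theorem blk_S_zero_offdiag (κ : Fin 4) (u : Fin 4 → ℤ) {b b' : Bool} (hbb : ¬(b = true ∧ b' = true)) :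
    blk ((JsB12Sym0 hLc N tabs cΛ cB 0).S κ u) b b' =
      (-((Lc : ℝ) ^ 8 / 2)) • blk (tabs.V κ u) b b' + cΛ • blk (SLam Lc (lamCoeffOf (KInv (N := Lc) (d := 3)) Lc) tabs.H κ u) b b' := by
  rw [blk_S_zero, blk_wilsonA_eq_zero κ u hbb, smul_zero, zero_add]

/-- [folklore] **LEVEL `j+1` OFF THE `tt` BLOCK: THE PROPAGATED CUBIC SECTOR IS ABSENT** — border + Λ-sector only. -/
theorem blk_S_succ_offdiag (j : ℕ) (κ : Fin 4) (u : Fin 4 → ℤ) {b b' : Bool} (hbb : ¬(b = true ∧ b' = true)) :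
    blk ((JsB12Sym0 hLc N tabs cΛ cB (j + 1)).S κ u) b b' =
      (-((Lc : ℝ) ^ 8 / 2) * wVH 3 Lc (j + 1)) • blk (tabs.V κ u) b b'
        + (cΛ * wΛ 3 Lc (j + 1)) • blk (SLam Lc (lamCoeffK (KInvStep (d := 3) Lc (j + 1)) (E2 3 Lc (j + 1)) Lc) tabs.H κ u) b b' := by
  rw [blk_S_succ, blk_e3OfK_eq_zero _ _ _ κ u hbb, smul_zero, zero_add]

/-- [folklore] **UNDER (BH), OFF THE `tt` BLOCK THE ROW IS THE BORDER SECTOR ALONE**, level `0`: `blk (S₀ κ u) b b′ = (−Lc⁸∕2) • blk (tabs.V κ u) b b′`. -/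
theorem blk_S_zero_offdiag_of_BH {b b' : Bool} (hbb : ¬(b = true ∧ b' = true)) (hBH : ∀ μ y, blk (tabs.H μ y) b b' = 0)
    (κ : Fin 4) (u : Fin 4 → ℤ) :
    blk ((JsB12Sym0 hLc N tabs cΛ cB 0).S κ u) b b' = (-((Lc : ℝ) ^ 8 / 2)) • blk (tabs.V κ u) b b' := by
  rw [blk_S_zero_offdiag hLc N tabs cΛ cB κ u hbb, blk_SLam_eq_zero Lc _ hBH, smul_zero, add_zero]

/-- [folklore] **UNDER (BH), OFF THE `tt` BLOCK THE ROW IS THE BORDER SECTOR ALONE**, level `j+1`: weight `−Lc⁸∕2·wVH 3 Lc (j+1)` (= `−Lc⁸∕2·(Lc^{j+1})¹⁰`,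
`SymmetrisedStepJetsUnits.wVH_three`). -/
theorem blk_S_succ_offdiag_of_BH {b b' : Bool} (hbb : ¬(b = true ∧ b' = true)) (hBH : ∀ μ y, blk (tabs.H μ y) b b' = 0)
    (j : ℕ) (κ : Fin 4) (u : Fin 4 → ℤ) :
    blk ((JsB12Sym0 hLc N tabs cΛ cB (j + 1)).S κ u) b b' = (-((Lc : ℝ) ^ 8 / 2) * wVH 3 Lc (j + 1)) • blk (tabs.V κ u) b b' := by
  rw [blk_S_succ_offdiag hLc N tabs cΛ cB j κ u hbb, blk_SLam_eq_zero Lc _ hBH, smul_zero, add_zero]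

/-- [folklore] **UNDER (BV), THE `tt` ROW IS CUBIC + Λ (NO BORDER)**, level `0`. -/
theorem blk_S_zero_tt_of_BV (hBV : ∀ κ u, blk (tabs.V κ u) true true = 0) (κ : Fin 4) (u : Fin 4 → ℤ) :
    blk ((JsB12Sym0 hLc N tabs cΛ cB 0).S κ u) true true =
      ((Lc : ℝ) ^ 4) • blk (wilsonA 3 κ u) true true + cΛ • blk (SLam Lc (lamCoeffOf (KInv (N := Lc) (d := 3)) Lc) tabs.H κ u) true true := by
  rw [blk_S_zero, hBV, smul_zero, add_zero]

/-- [folklore] **UNDER (BV), THE `tt` ROW IS PROPAGATED CUBIC + Λ (NO BORDER)**, level `j+1`. -/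
theorem blk_S_succ_tt_of_BV (hBV : ∀ κ u, blk (tabs.V κ u) true true = 0) (j : ℕ) (κ : Fin 4) (u : Fin 4 → ℤ) :
    blk ((JsB12Sym0 hLc N tabs cΛ cB (j + 1)).S κ u) true true =
      ((Lc : ℝ) ^ 4 * wE 3 Lc (j + 1)) • blk (e3OfK Lc (Gsym Lc j) (JsB12Sym0 hLc N tabs cΛ cB j).S κ u) true true
        + (cΛ * wΛ 3 Lc (j + 1)) • blk (SLam Lc (lamCoeffK (KInvStep (d := 3) Lc (j + 1)) (E2 3 Lc (j + 1)) Lc) tabs.H κ u) true true := by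
  rw [blk_S_succ, hBV, smul_zero, add_zero]

/-- [folklore] **UNDER (BV)+(BH), THE `ff` (multiplier–multiplier) ROW VANISHES**, every level. -/
theorem blk_S_ff_eq_zero (hBV : ∀ κ u, blk (tabs.V κ u) false false = 0) (hBH : ∀ μ y, blk (tabs.H μ y) false false = 0) :
    ∀ (j : ℕ) (κ : Fin 4) (u : Fin 4 → ℤ), blk ((JsB12Sym0 hLc N tabs cΛ cB j).S κ u) false false = 0
  | 0, κ, u => by rw [blk_S_zero_offdiag_of_BH hLc N tabs cΛ cB (by simp) hBH κ u, hBV, smul_zero]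
  | j + 1, κ, u => by rw [blk_S_succ_offdiag_of_BH hLc N tabs cΛ cB (by simp) hBH j κ u, hBV, smul_zero]

/-- [folklore] **THE PURE PART OFF THE `tt` BLOCK IS THE BORDER SECTOR ALONE — UNCONDITIONALLY** (no Λ-sector in `SpureSymOf`), level `0`. -/
theorem blk_Spure_zero_offdiag (cE cVH cΛ' : ℝ) (κ : Fin 4) (u : Fin 4 → ℤ) {b b' : Bool} (hbb : ¬(b = true ∧ b' = true)) :
    blk (SpureSymOf tabs cE cVH cΛ' 0 κ u) b b' = cVH • blk (tabs.V κ u) b b' := by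
  unfold SpureSymOf; rw [SpureRecOf_zero_level]
  show blk (cE • wilsonA 3 κ u + cVH • tabs.V κ u) b b' = _
  rw [blk_add, blk_smul, blk_smul, blk_wilsonA_eq_zero κ u hbb, smul_zero, zero_add]

/-- [folklore] **THE PURE PART OFF THE `tt` BLOCK IS THE BORDER SECTOR ALONE — UNCONDITIONALLY**, level `j+1` (weight `cVH·wVH 3 Lc (j+1)`). -/
theorem blk_Spure_succ_offdiag (cE cVH cΛ' : ℝ) (j : ℕ) (κ : Fin 4) (u : Fin 4 → ℤ) {b b' : Bool} (hbb : ¬(b = true ∧ b' = true)) :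
    blk (SpureSymOf tabs cE cVH cΛ' (j + 1) κ u) b b' = (cVH * wVH 3 Lc (j + 1)) • blk (tabs.V κ u) b b' := by
  unfold SpureSymOf; rw [SpureRecOf_succ]
  show blk ((cE * wE 3 Lc (j + 1)) • e3OfK Lc (Gsym Lc j) (SrecOf 3 Lc tabs.V tabs.H (Gsym Lc) cE cVH cΛ' j) κ u
    + (cVH * wVH 3 Lc (j + 1)) • tabs.V κ u) b b' = _
  rw [blk_add, blk_smul, blk_smul, blk_e3OfK_eq_zero _ _ _ κ u hbb, smul_zero, zero_add]

end FirstOrder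

/-! ## §4 The literal's second-order rows -/

section SecondOrder

variable {Lc : ℕ} [NeZero Lc] (hLc : Odd Lc) (N : ℕ) (tabs : SymTables 3 Lc) (cΛ cB : ℝ)

/-- [folklore] **THE BI-STENCIL `T2RecOf … 0` OFF THE `tt` BLOCK IS THE SECOND-ORDER BORDER `cB • tabs.vh₂S` ALONE** (the Wilson quartic sector is
`tt`-only). -/
theorem blk_T2Rec_zero_offdiag (κ : Fin 4) (u : Fin 4 → ℤ) (κ' : Fin 4) (u' : Fin 4 → ℤ) {b b' : Bool} (hbb : ¬(b = true ∧ b' = true)) :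
    blk (T2RecOf 3 Lc (Gsym Lc) (SpureSymOf tabs ((Lc : ℝ) ^ 4) (-((Lc : ℝ) ^ 8 / 2)) cΛ) tabs.M ((Lc : ℝ) ^ 8) cB
        ((8 * (N : ℝ) ^ 2)⁻¹ • wsym22 N) tabs.vh₂S tabs.mixFF 0 κ u κ' u') b b' = cB • blk (tabs.vh₂S κ u κ' u') b b' := by
  rw [T2RecOf_zero_level]
  show blk (((Lc : ℝ) ^ 8) • wilsonW₂ 3 ((8 * (N : ℝ) ^ 2)⁻¹ • wsym22 N) κ u κ' u' + cB • tabs.vh₂S κ u κ' u') b b' = _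
  rw [blk_add, blk_smul, blk_smul, blk_wilsonW₂_eq_zero _ κ u κ' u' hbb, smul_zero, zero_add]

/-- [folklore] **THE BI-STENCIL `T2RecOf … (j+1)` OFF THE `tt` BLOCK IS THE SECOND-ORDER BORDER `(cB·wB2 3 Lc (j+1)) • tabs.vh₂S` ALONE** (the
propagated quartic sector `e4OfKW` is `tt`-only). -/
theorem blk_T2Rec_succ_offdiag (j : ℕ) (κ : Fin 4) (u : Fin 4 → ℤ) (κ' : Fin 4) (u' : Fin 4 → ℤ) {b b' : Bool} (hbb : ¬(b = true ∧ b' = true)) :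
    blk (T2RecOf 3 Lc (Gsym Lc) (SpureSymOf tabs ((Lc : ℝ) ^ 4) (-((Lc : ℝ) ^ 8 / 2)) cΛ) tabs.M ((Lc : ℝ) ^ 8) cB
        ((8 * (N : ℝ) ^ 2)⁻¹ • wsym22 N) tabs.vh₂S tabs.mixFF (j + 1) κ u κ' u') b b'
      = (cB * wB2 3 Lc (j + 1)) • blk (tabs.vh₂S κ u κ' u') b b' := by
  rw [T2RecOf_succ]; dsimp only
  rw [blk_add, blk_smul, blk_smul, blk_e4OfKW_eq_zero _ _ _ _ _ _ _ _ _ hbb, smul_zero, zero_add]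

/-- [folklore] **THE SECOND-ORDER ROW OFF THE `tt` BLOCK, SUMMAND BY SUMMAND** (`W2OfK_apply`, both orders of the coarse bonds): under (Bmix) the two mixed
bi-vertex summands VANISH; under (BM) the response summand `dM (K2OfK …)` reads only the field tables; what is left is the bi-vertex of the bi-stencil
`T2_j` read through its off-`tt` rows (= the second-order border, `blk_T2Rec_*_offdiag`) and the response summand read through the off-`tt` rows of the pure
first-order tables (= the first-order border, `blk_Spure_*_offdiag`) — with the tables REPLACED by those border sectors inside the block (CONGRUENCE). -/
theorem blk_W_offdiag_of_letters (j : ℕ) {b b' : Bool}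
    (hBmix : ∀ κ u ρ w, blk (tabs.mixFF κ u ρ w) b b' = 0) (hBM : ∀ ρ w, blk (tabs.M j ρ w) b b' = 0)
    {B₁ : Fin 4 → (Fin 4 → ℤ) → MKer 4 (Fib 3)} (hB₁ : ∀ κ u, blk (SpureSymOf tabs ((Lc : ℝ) ^ 4) (-((Lc : ℝ) ^ 8 / 2)) cΛ j κ u) b b' = blk (B₁ κ u) b b')
    {B₂ : Fin 4 → (Fin 4 → ℤ) → Fin 4 → (Fin 4 → ℤ) → MKer 4 (Fib 3)}
    (hB₂ : ∀ κ u κ' u', blk (T2RecOf 3 Lc (Gsym Lc) (SpureSymOf tabs ((Lc : ℝ) ^ 4) (-((Lc : ℝ) ^ 8 / 2)) cΛ) tabs.M ((Lc : ℝ) ^ 8) cB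
        ((8 * (N : ℝ) ^ 2)⁻¹ • wsym22 N) tabs.vh₂S tabs.mixFF j κ u κ' u') b b' = blk (B₂ κ u κ' u') b b')
    (μ : Fin 4) (y : Fin 4 → ℤ) (ν : Fin 4) (y' : Fin 4 → ℤ) :
    blk ((JsB12Sym0 hLc N tabs cΛ cB j).W μ y ν y') b b' =
      (1 / 2 : ℝ) •
        (blk (vertex2OfK (Gsym Lc j) Lc B₂ μ y ν y') b b'
          + blk (vertexOfK (K2OfK (Gsym Lc j) Lc (SpureSymOf tabs ((Lc : ℝ) ^ 4) (-((Lc : ℝ) ^ 8 / 2)) cΛ j) (tabs.M j) ν y') Lc B₁ μ y) b b'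
          + (blk (vertex2OfK (Gsym Lc j) Lc B₂ ν y' μ y) b b'
            + blk (vertexOfK (K2OfK (Gsym Lc j) Lc (SpureSymOf tabs ((Lc : ℝ) ^ 4) (-((Lc : ℝ) ^ 8 / 2)) cΛ j) (tabs.M j) μ y) Lc B₁ ν y')
              b b')) := by
  have hM2 : ∀ κ u ρ w, blk (M2Of 3 Lc tabs.mixFF j κ u ρ w) b b' = 0 := fun κ u ρ w => by
    unfold M2Of; rw [blk_smul, hBmix, smul_zero]
  rw [JsB12Sym0_W_eq]
  unfold W2SymOfK
  rw [blk_smul, blk_add, W2OfK_apply, W2OfK_apply]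
  simp only [blk_add, blk_mixOfK_eq_zero (Gsym Lc j) Lc hM2, add_zero, blk_vertex2OfK_congr (Gsym Lc j) Lc hB₂,
    blk_dM_of_letters _ Lc hB₁ hBM]

/-- [folklore] **VANISHING OF THE SECOND-ORDER ROW's BLOCK** when all four border∕mixed∕multiplier tables vanish on it (e.g. the `ff` block under
(BV-ff)+(BB-ff)+(BM)+(Bmix)): every summand of `W2OfK_apply` vanishes. -/
theorem blk_W_eq_zero_of_letters (j : ℕ) {b b' : Bool} (hbb : ¬(b = true ∧ b' = true))
    (hBmix : ∀ κ u ρ w, blk (tabs.mixFF κ u ρ w) b b' = 0) (hBM : ∀ ρ w, blk (tabs.M j ρ w) b b' = 0)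
    (hBV : ∀ κ u, blk (tabs.V κ u) b b' = 0) (hBB : ∀ κ u κ' u', blk (tabs.vh₂S κ u κ' u') b b' = 0)
    (μ : Fin 4) (y : Fin 4 → ℤ) (ν : Fin 4) (y' : Fin 4 → ℤ) :
    blk ((JsB12Sym0 hLc N tabs cΛ cB j).W μ y ν y') b b' = 0 := by
  have hB₁ : ∀ κ u, blk (SpureSymOf tabs ((Lc : ℝ) ^ 4) (-((Lc : ℝ) ^ 8 / 2)) cΛ j κ u) b b' = blk ((fun _ _ => (0 : MKer 4 (Fib 3))) κ u) b b' := by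
    intro κ u
    rcases j with _ | j
    · rw [blk_Spure_zero_offdiag tabs _ _ _ κ u hbb, hBV, smul_zero, blk_zero]
    · rw [blk_Spure_succ_offdiag tabs _ _ _ j κ u hbb, hBV, smul_zero, blk_zero]
  have hB₂ : ∀ κ u κ' u', blk (T2RecOf 3 Lc (Gsym Lc) (SpureSymOf tabs ((Lc : ℝ) ^ 4) (-((Lc : ℝ) ^ 8 / 2)) cΛ) tabs.M ((Lc : ℝ) ^ 8) cB
      ((8 * (N : ℝ) ^ 2)⁻¹ • wsym22 N) tabs.vh₂S tabs.mixFF j κ u κ' u') b b' = blk ((fun _ _ _ _ => (0 : MKer 4 (Fib 3))) κ u κ' u') b b' := by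
    intro κ u κ' u'
    rcases j with _ | j
    · rw [blk_T2Rec_zero_offdiag N tabs cΛ cB κ u κ' u' hbb, hBB, smul_zero, blk_zero]
    · rw [blk_T2Rec_succ_offdiag N tabs cΛ cB j κ u κ' u' hbb, hBB, smul_zero, blk_zero]
  rw [blk_W_offdiag_of_letters hLc N tabs cΛ cB j hBmix hBM hB₁ hB₂ μ y ν y',
    blk_vertex2OfK_eq_zero _ _ (fun _ _ _ _ => blk_zero b b'), blk_vertex2OfK_eq_zero _ _ (fun _ _ _ _ => blk_zero b b'),
    blk_vertexOfK_eq_zero _ _ (fun _ _ => blk_zero b b'), blk_vertexOfK_eq_zero _ _ (fun _ _ => blk_zero b b')]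
  simp

end SecondOrder

end Summit.QuantumFields.BalabanUV.Beta.FP.SymJetBlockRows

end
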